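import Mathlib
import HarnessLib
import Summits.HubbardSuperconductivity.HubbardSuperconductivity.Theorems.KLProgrammeCooperChannelRiccatiFlowCascade
import Summits.HubbardSuperconductivity.HubbardSuperconductivity.Theorems.KLProgrammeCooperChannelRiccatiFlowEnvelope

/-!
# Route `KLProgramme` — DECOMP C2 «ChannelRiccati» in Lean, V: the diagonal supersolution
# (the upper bound for the bottom of the leading block; the gap of C2 (c))

Cell gate-hubbard-kl, seat p3; continuation of files I–IV (same namespace).  The lower envelopes of file IV
(`blockFlow_envelopes`) bound every block's form from BELOW by the attractive envelope of its total drive.  The gap of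
DECOMP C2 (c) — «`λ_min(Γ-block) - λ_min(B1g-block) ≥ γ U² (1 - O(U) - …)` on the whole range» — needs in addition an
UPPER bound for the bottom of the leading (`B1g`) block that sees the SIGN of its drive, which no norm bound can give.
It comes from a trial vector:

* `re_inner_inverse_apply_ge` — `Re ⟪u, (1 + bV)⁻¹ u⟫ ≥ (4/5) ‖u‖²` for `b ≥ 0`, `b ‖V‖ ≤ 1/4`;
* `re_inner_mul_inverse_le` — along any unit vector `ψ` the exact ladder step is a SUBsolution of a Riccati step with
  weight `(4/5) b`: `Re ⟪ψ, V (1 + bV)⁻¹ ψ⟫ ≤ Re ⟪ψ, V ψ⟫ - (4/5) b (Re ⟪ψ, V ψ⟫)²` (symmetric `V`), in particular it never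
  raises the diagonal (`re_inner_mul_inverse_le'`);
* `re_inner_le_diagonal_sum` / `formInf_le_diagonal_sum` — along a block flow `V_{k+1} = V_k R_k + P_k`:
  `formInf V_k ≤ Re ⟪ψ, V_k ψ⟫ ≤ Re ⟪ψ, V₀ ψ⟫ + Σ_{j<k} Re ⟪ψ, P_j ψ⟫` — the bottom of the leading block is at most the
  ACCUMULATED DIAGONAL DRIVE along `ψ`; with `ψ` a near-minimising `B1g` channel state of the certificate this is
  `-(a_{B1g} - radius) U²` up to the summable remainders (the pairing form of the Kohn–Luttinger kernel at `ψ` is exactly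
  what CERT-TABLE / `channelInf` enclose);
* `gap_of_envelope_of_diagonal` — the resulting gap `formInf W_k - formInf V_k ≥ attractiveEnvelope A' B_k - (t₀ + D_k)`
  between a competing block `W` (lower envelope of file IV with total drive `A' = a_Γ⁺ U²`) and the leading block
  (`-(t₀ + D_k) = a_{B1g}⁻ U²`): positive as long as `a_Γ⁺ U² B_k < 1 - a_Γ⁺ / a_{B1g}⁻`.

References: HOME/DECOMP.md v7 §2 C2 (c), App. E (E2 (b), Lemma E.4); CERT-TABLE (certified channel table).
-/

noncomputable section

namespace Summit.HubbardSuperconductivity.HubbardSuperconductivity.Theorems.CooperChannelRiccatiFlow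

set_option linter.dupNamespace false -- summit = problem name (single-conjunct summit), D-0017

open scoped InnerProductSpace ComplexConjugate
open RCLike ContinuousLinearMap Finset

variable {E : Type*} [NormedAddCommGroup E] [InnerProductSpace ℂ E]

/-! ## The diagonal supersolution: the bottom of the leading block along a fixed form factor -/

section Diagonal

variable {V R : E →L[ℂ] E} {b : ℝ}

/-- The inverse of `1 + b V` is bounded below as a form: `Re ⟪u, R u⟫ ≥ (4/5) ‖u‖²` (`b ≥ 0`, `b ‖V‖ ≤ 1/4`,
`(1 + b V) R = 1`; no symmetry needed). -/
theorem re_inner_inverse_apply_ge (hb : 0 ≤ b) (hbV : b * ‖V‖ ≤ 1 / 4)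
    (hR₁ : (1 + b • V) * R = 1) (u : E) : 4 / 5 * ‖u‖ ^ 2 ≤ re ⟪u, R u⟫_ℂ := by
  set z : E := R u with hz
  have hu : (1 + b • V) z = u := by
    have h := congrArg (fun S : E →L[ℂ] E => S u) hR₁
    exact h
  have h1 : re ⟪u, z⟫_ℂ = ‖z‖ ^ 2 + b * re ⟪z, V z⟫_ℂ := by
    rw [← hu, one_add_smul_apply, inner_add_left, map_add, re_inner_real_smul_left, inner_re_symm (V z) z,
      inner_self_eq_norm_sq (𝕜 := ℂ)]
  have h2 : ‖u‖ ^ 2 = ‖z‖ ^ 2 + 2 * b * re ⟪z, V z⟫_ℂ + b ^ 2 * ‖V z‖ ^ 2 := by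
    rw [← hu]
    exact norm_sq_one_add_smul_apply b V z
  have h3 : |re ⟪z, V z⟫_ℂ| ≤ ‖V‖ * ‖z‖ ^ 2 := by
    calc |re ⟪z, V z⟫_ℂ| ≤ ‖⟪z, V z⟫_ℂ‖ := RCLike.abs_re_le_norm _
      _ ≤ ‖z‖ * ‖V z‖ := norm_inner_le_norm _ _
      _ ≤ ‖z‖ * (‖V‖ * ‖z‖) := by gcongr; exact V.le_opNorm z
      _ = ‖V‖ * ‖z‖ ^ 2 := by ring
  have h4 : ‖V z‖ ≤ ‖V‖ * ‖z‖ := V.le_opNorm z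
  have hz0 : 0 ≤ ‖z‖ ^ 2 := sq_nonneg _
  have hbr : |b * re ⟪z, V z⟫_ℂ| ≤ ‖z‖ ^ 2 / 4 := by
    rw [abs_mul, abs_of_nonneg hb]
    calc b * |re ⟪z, V z⟫_ℂ| ≤ b * (‖V‖ * ‖z‖ ^ 2) := by gcongr
      _ = (b * ‖V‖) * ‖z‖ ^ 2 := by ring
      _ ≤ (1 / 4) * ‖z‖ ^ 2 := by gcongr
      _ = ‖z‖ ^ 2 / 4 := by ring
  have hbt : b ^ 2 * ‖V z‖ ^ 2 ≤ ‖z‖ ^ 2 / 16 := by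
    have hVz0 : 0 ≤ ‖V z‖ := norm_nonneg _
    have : b * ‖V z‖ ≤ (1 / 4) * ‖z‖ := by
      calc b * ‖V z‖ ≤ b * (‖V‖ * ‖z‖) := by gcongr
        _ = (b * ‖V‖) * ‖z‖ := by ring
        _ ≤ (1 / 4) * ‖z‖ := by gcongr
    have hbVz0 : 0 ≤ b * ‖V z‖ := mul_nonneg hb hVz0
    nlinarith
  obtain ⟨hbr1, hbr2⟩ := abs_le.mp hbr
  rw [hz] at h1 h2 hbr1 hbr2 hbt
  rw [h1, h2]
  linarith

/-- **Diagonal supersolution, one step.**  For symmetric `V`, `b ≥ 0`, `b ‖V‖ ≤ 1/4`, `R` a two-sided inverse of `1 + b V`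
and a unit vector `ψ`: `Re ⟪ψ, V R ψ⟫ ≤ Re ⟪ψ, V ψ⟫ - (4/5) b (Re ⟪ψ, V ψ⟫)²` — along a fixed direction the exact ladder
step is a SUBsolution of a Riccati step with weight `(4/5) b`. -/
theorem re_inner_mul_inverse_le (hV : (V : E →ₗ[ℂ] E).IsSymmetric) (hb : 0 ≤ b) (hbV : b * ‖V‖ ≤ 1 / 4)
    (hR₁ : (1 + b • V) * R = 1) (hR₂ : R * (1 + b • V) = 1) {ψ : E} (hψ : ‖ψ‖ = 1) :
    re ⟪ψ, (V * R) ψ⟫_ℂ ≤ re ⟪ψ, V ψ⟫_ℂ - 4 / 5 * b * (re ⟪ψ, V ψ⟫_ℂ) ^ 2 := by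
  -- `R ψ = ψ - b R V ψ`, so `V R ψ = V ψ - b V R V ψ`
  have hRψ : R ψ = ψ - (b : ℂ) • R (V ψ) := by
    have h : R ((1 + b • V) ψ) = ψ := by
      have h' := congrArg (fun S : E →L[ℂ] E => S ψ) hR₂
      exact h'
    rw [one_add_smul_apply, map_add, map_smul] at h
    exact eq_sub_of_add_eq h
  have hVR : (V * R) ψ = V ψ - (b : ℂ) • V (R (V ψ)) := by
    show V (R ψ) = _
    rw [hRψ, map_sub, map_smul]
  have hsym : re ⟪ψ, V (R (V ψ))⟫_ℂ = re ⟪V ψ, R (V ψ)⟫_ℂ := by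
    rw [← hV.apply_clm ψ (R (V ψ))]
  have hgain := re_inner_inverse_apply_ge hb hbV hR₁ (V ψ)
  have hcs : (re ⟪ψ, V ψ⟫_ℂ) ^ 2 ≤ ‖V ψ‖ ^ 2 := by
    have h : |re ⟪ψ, V ψ⟫_ℂ| ≤ ‖V ψ‖ := by
      calc |re ⟪ψ, V ψ⟫_ℂ| ≤ ‖⟪ψ, V ψ⟫_ℂ‖ := RCLike.abs_re_le_norm _
        _ ≤ ‖ψ‖ * ‖V ψ‖ := norm_inner_le_norm _ _
        _ = ‖V ψ‖ := by rw [hψ, one_mul]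
    obtain ⟨h₁, h₂⟩ := abs_le.mp h
    exact sq_le_sq' h₁ h₂
  rw [hVR, inner_sub_right, map_sub, re_inner_real_smul_right, hsym]
  nlinarith [mul_le_mul_of_nonneg_left hgain hb, mul_le_mul_of_nonneg_left hcs hb]

/-- In particular the diagonal never increases under the ladder step: `Re ⟪ψ, V R ψ⟫ ≤ Re ⟪ψ, V ψ⟫`. -/
theorem re_inner_mul_inverse_le' (hV : (V : E →ₗ[ℂ] E).IsSymmetric) (hb : 0 ≤ b) (hbV : b * ‖V‖ ≤ 1 / 4)
    (hR₁ : (1 + b • V) * R = 1) (hR₂ : R * (1 + b • V) = 1) {ψ : E} (hψ : ‖ψ‖ = 1) :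
    re ⟪ψ, (V * R) ψ⟫_ℂ ≤ re ⟪ψ, V ψ⟫_ℂ := by
  have h := re_inner_mul_inverse_le hV hb hbV hR₁ hR₂ hψ
  nlinarith [sq_nonneg (re ⟪ψ, V ψ⟫_ℂ)]

end Diagonal

section DiagonalFlow

variable {V R : ℕ → E →L[ℂ] E} {b : ℕ → ℝ} {N : ℕ} {ψ : E}

/-- **Diagonal supersolution along the flow.**  For a block flow with symmetric `V_k`, `b_k ≥ 0`, `b_k ‖V_k‖ ≤ 1/4` and
two-sided inverses `R_k` of `1 + b_k V_k` (`k < N`), and any unit vector `ψ`: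
`Re ⟪ψ, V_k ψ⟫ ≤ Re ⟪ψ, V₀ ψ⟫ + Σ_{j<k} Re ⟪ψ, (V_{j+1} - V_j R_j) ψ⟫` for all `k ≤ N` — the diagonal is at most the
ACCUMULATED DIAGONAL DRIVE (the ladder steps only lower it). -/
theorem re_inner_le_diagonal_sum (hψ : ‖ψ‖ = 1) (hV : ∀ k, (V k : E →ₗ[ℂ] E).IsSymmetric) (hb : ∀ k, 0 ≤ b k)
    (hbV : ∀ k < N, b k * ‖V k‖ ≤ 1 / 4)
    (hR : ∀ k < N, (1 + b k • V k) * R k = 1 ∧ R k * (1 + b k • V k) = 1) :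
    ∀ k ≤ N, re ⟪ψ, V k ψ⟫_ℂ ≤ re ⟪ψ, V 0 ψ⟫_ℂ + ∑ j ∈ range k, re ⟪ψ, (V (j + 1) - V j * R j) ψ⟫_ℂ := by
  intro k
  induction k with
  | zero => intro; simp
  | succ k ih =>
    intro hk
    have hk' : k < N := Nat.lt_of_succ_le hk
    obtain ⟨hR₁, hR₂⟩ := hR k hk'
    have hstep := re_inner_mul_inverse_le' (hV k) (hb k) (hbV k hk') hR₁ hR₂ hψ
    have hsplit : re ⟪ψ, V (k + 1) ψ⟫_ℂ = re ⟪ψ, (V k * R k) ψ⟫_ℂ + re ⟪ψ, (V (k + 1) - V k * R k) ψ⟫_ℂ := by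
      rw [← map_add, ← inner_add_right]
      congr 2
      show V (k + 1) ψ = (V k * R k) ψ + (V (k + 1) ψ - (V k * R k) ψ)
      abel
    rw [sum_range_succ, hsplit]
    linarith [ih hk'.le]

/-- **The bottom of the leading block is at most the accumulated diagonal drive** along any unit vector `ψ`:
`formInf V_k ≤ Re ⟪ψ, V₀ ψ⟫ + Σ_{j<k} Re ⟪ψ, (V_{j+1} - V_j R_j) ψ⟫` (DECOMP C2 (c): with `ψ` a near-minimising channel state
of the certificate, the right-hand side is `-(a_{B1g} - radius) U²` up to the summable remainders). -/
theorem formInf_le_diagonal_sum (hψ : ‖ψ‖ = 1) (hV : ∀ k, (V k : E →ₗ[ℂ] E).IsSymmetric) (hb : ∀ k, 0 ≤ b k)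
    (hbV : ∀ k < N, b k * ‖V k‖ ≤ 1 / 4)
    (hR : ∀ k < N, (1 + b k • V k) * R k = 1 ∧ R k * (1 + b k • V k) = 1) {k : ℕ} (hk : k ≤ N) :
    formInf (V k) ≤ re ⟪ψ, V 0 ψ⟫_ℂ + ∑ j ∈ range k, re ⟪ψ, (V (j + 1) - V j * R j) ψ⟫_ℂ :=
  (formInf_le (V k) hψ).trans (re_inner_le_diagonal_sum hψ hV hb hbV hR k hk)

/-- **Gap of DECOMP C2 (c), assembled form.**  If a competing block `W_k` obeys the attractive lower envelope
`attractiveEnvelope A' B ≤ formInf W_k` and the leading block obeys the diagonal bound `formInf V_k ≤ t₀ + D` (accumulated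
diagonal drive `D` along a form factor), then `formInf W_k - formInf V_k ≥ attractiveEnvelope A' B - t₀ - D`; in the programme
`A' = a_Γ⁺ U²`, `-(t₀ + D) = a_{B1g}⁻ U²`, so the gap is `≥ (a_{B1g}⁻ - a_Γ⁺/(1 - a_Γ⁺ U² B)) U²`. -/
theorem gap_of_envelope_of_diagonal {W Vk : E →L[ℂ] E} {A' B t₀ D : ℝ}
    (hW : attractiveEnvelope A' B ≤ formInf W) (hV : formInf Vk ≤ t₀ + D) :
    attractiveEnvelope A' B - t₀ - D ≤ formInf W - formInf Vk := by
  linarith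

end DiagonalFlow

/-! ## Sharp form of the diagonal gain (symmetric `V`): weight `b / (1 + b ‖V‖)` instead of `(4/5) b`

For the gap of DECOMP C2 (c) near the onset the constant in front of the Riccati gain matters: with the crude `4/5` the
diagonal upper bound of the leading block saturates at `5 a_{B1g} U²`, so a competitor with certified ratio
`r = a_Γ⁺ / a_{B1g}⁻ > 5/6` could not be separated on the whole `(1 - η)`-range (CERT-TABLE's far-channel bounds give
`r = 0.90` at `δ = 0.20`, `0.72` at `δ = 0.10`).  The sharp weight `b / (1 + b ‖V‖) = b (1 - O(U²))` removes the
constraint: any certified `r < 1` suffices, and the Riccati subsolution is in turn below a cascade step with weight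
reduced by a factor `1 - ε` as long as `b |t| ≤ ε` (`riccatiStep_le_cascadeStep_of_small`), so the diagonal of the leading
block is a cascade SUBsolution with weights `b_k (1 - ε) / (1 + b_k ‖V_k‖)` — the mirror image of the competitors'
attractive lower envelopes, with `a_±`-type constants only. -/

section Sharp

variable {V R : E →L[ℂ] E} {b : ℝ}

/-- `Re ⟪(1 + b V) w, w⟫ = ‖w‖² + b · Re ⟪w, V w⟫`. -/
theorem re_inner_one_add_smul_apply_self (b : ℝ) (V : E →L[ℂ] E) (w : E) :
    re ⟪(1 + b • V) w, w⟫_ℂ = ‖w‖ ^ 2 + b * re ⟪w, V w⟫_ℂ := by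
  rw [one_add_smul_apply, inner_add_left, map_add, re_inner_real_smul_left, inner_re_symm (V w) w,
    inner_self_eq_norm_sq (𝕜 := ℂ)]

/-- `1 + b V` is a positive operator for symmetric `V` and `|b| ‖V‖ ≤ 1/4`. -/
theorem isPositive_one_add_smul (hV : (V : E →ₗ[ℂ] E).IsSymmetric) (hb : |b| * ‖V‖ ≤ 1 / 4) :
    (1 + b • V).IsPositive := by
  refine ⟨?_, fun w => ?_⟩
  · intro x y
    show ⟪(1 + b • V) x, y⟫_ℂ = ⟪x, (1 + b • V) y⟫_ℂ
    rw [one_add_smul_apply, one_add_smul_apply, inner_add_left, inner_add_right, inner_smul_left,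
      inner_smul_right, Complex.conj_ofReal, hV.apply_clm x y]
  · rw [reApplyInnerSelf_apply, re_inner_one_add_smul_apply_self]
    have h1 : |re ⟪w, V w⟫_ℂ| ≤ ‖V‖ * ‖w‖ ^ 2 := by
      calc |re ⟪w, V w⟫_ℂ| ≤ ‖⟪w, V w⟫_ℂ‖ := RCLike.abs_re_le_norm _
        _ ≤ ‖w‖ * ‖V w‖ := norm_inner_le_norm _ _
        _ ≤ ‖w‖ * (‖V‖ * ‖w‖) := by gcongr; exact V.le_opNorm w
        _ = ‖V‖ * ‖w‖ ^ 2 := by ring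
    have h2 : |b * re ⟪w, V w⟫_ℂ| ≤ ‖w‖ ^ 2 / 4 := by
      rw [abs_mul]
      calc |b| * |re ⟪w, V w⟫_ℂ| ≤ |b| * (‖V‖ * ‖w‖ ^ 2) := by gcongr
        _ = (|b| * ‖V‖) * ‖w‖ ^ 2 := by ring
        _ ≤ (1 / 4) * ‖w‖ ^ 2 := by gcongr
        _ = ‖w‖ ^ 2 / 4 := by ring
    have h3 := (abs_le.mp h2).1
    nlinarith [sq_nonneg ‖w‖]

/-- `‖1 + b V‖ ≤ 1 + b ‖V‖` for `b ≥ 0`. -/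
theorem norm_one_add_smul_le (hb : 0 ≤ b) (V : E →L[ℂ] E) : ‖1 + b • V‖ ≤ 1 + b * ‖V‖ := by
  calc ‖1 + b • V‖ ≤ ‖(1 : E →L[ℂ] E)‖ + ‖b • V‖ := norm_add_le _ _
    _ ≤ 1 + b * ‖V‖ := by
        rw [norm_smul, Real.norm_eq_abs, abs_of_nonneg hb]
        gcongr
        exact ContinuousLinearMap.norm_id_le

/-- **Sharp gain:** `Re ⟪u, (1 + bV)⁻¹ u⟫ ≥ ‖u‖² / (1 + b ‖V‖)` for symmetric `V`, `b ≥ 0`, `b ‖V‖ ≤ 1/4` and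
`(1 + b V) R = 1` (the Cauchy–Schwarz gain `‖S z‖² ≤ ‖S‖ Re ⟪S z, z⟫` for the positive operator `S = 1 + bV`). -/
theorem re_inner_inverse_apply_ge_sharp (hV : (V : E →ₗ[ℂ] E).IsSymmetric) (hb : 0 ≤ b) (hbV : b * ‖V‖ ≤ 1 / 4)
    (hR₁ : (1 + b • V) * R = 1) (u : E) : ‖u‖ ^ 2 / (1 + b * ‖V‖) ≤ re ⟪u, R u⟫_ℂ := by
  set z : E := R u with hz
  have hu : (1 + b • V) z = u := by
    have h := congrArg (fun S : E →L[ℂ] E => S u) hR₁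
    exact h
  have hpos := isPositive_one_add_smul hV (show |b| * ‖V‖ ≤ 1 / 4 by rwa [abs_of_nonneg hb])
  have hcs := hpos.norm_apply_sq_le z
  have hre : 0 ≤ re ⟪u, z⟫_ℂ := by
    have h := hpos.2 z
    rw [reApplyInnerSelf_apply, hu] at h
    exact h
  rw [hu] at hcs
  have hden : 0 < 1 + b * ‖V‖ := by positivity
  rw [div_le_iff₀ hden]
  calc ‖u‖ ^ 2 ≤ ‖1 + b • V‖ * re ⟪u, z⟫_ℂ := hcs
    _ ≤ (1 + b * ‖V‖) * re ⟪u, z⟫_ℂ := by gcongr; exact norm_one_add_smul_le hb V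
    _ = re ⟪u, z⟫_ℂ * (1 + b * ‖V‖) := by ring

/-- **Diagonal supersolution, sharp one step:** for symmetric `V`, `b ≥ 0`, `b ‖V‖ ≤ 1/4`, `R` a two-sided inverse of
`1 + b V` and a unit vector `ψ`: `Re ⟪ψ, V R ψ⟫ ≤ Re ⟪ψ, V ψ⟫ - (b / (1 + b ‖V‖)) (Re ⟪ψ, V ψ⟫)²`. -/
theorem re_inner_mul_inverse_le_sharp (hV : (V : E →ₗ[ℂ] E).IsSymmetric) (hb : 0 ≤ b) (hbV : b * ‖V‖ ≤ 1 / 4)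
    (hR₁ : (1 + b • V) * R = 1) (hR₂ : R * (1 + b • V) = 1) {ψ : E} (hψ : ‖ψ‖ = 1) :
    re ⟪ψ, (V * R) ψ⟫_ℂ ≤ re ⟪ψ, V ψ⟫_ℂ - b / (1 + b * ‖V‖) * (re ⟪ψ, V ψ⟫_ℂ) ^ 2 := by
  have hRψ : R ψ = ψ - (b : ℂ) • R (V ψ) := by
    have h : R ((1 + b • V) ψ) = ψ := by
      have h' := congrArg (fun S : E →L[ℂ] E => S ψ) hR₂
      exact h'
    rw [one_add_smul_apply, map_add, map_smul] at h
    exact eq_sub_of_add_eq h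
  have hVR : (V * R) ψ = V ψ - (b : ℂ) • V (R (V ψ)) := by
    show V (R ψ) = _
    rw [hRψ, map_sub, map_smul]
  have hsym : re ⟪ψ, V (R (V ψ))⟫_ℂ = re ⟪V ψ, R (V ψ)⟫_ℂ := by
    rw [← hV.apply_clm ψ (R (V ψ))]
  have hgain := re_inner_inverse_apply_ge_sharp hV hb hbV hR₁ (V ψ)
  have hden : 0 < 1 + b * ‖V‖ := by positivity
  have hcs : (re ⟪ψ, V ψ⟫_ℂ) ^ 2 ≤ ‖V ψ‖ ^ 2 := by
    have h : |re ⟪ψ, V ψ⟫_ℂ| ≤ ‖V ψ‖ := by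
      calc |re ⟪ψ, V ψ⟫_ℂ| ≤ ‖⟪ψ, V ψ⟫_ℂ‖ := RCLike.abs_re_le_norm _
        _ ≤ ‖ψ‖ * ‖V ψ‖ := norm_inner_le_norm _ _
        _ = ‖V ψ‖ := by rw [hψ, one_mul]
    obtain ⟨h₁, h₂⟩ := abs_le.mp h
    exact sq_le_sq' h₁ h₂
  have hcs' : (re ⟪ψ, V ψ⟫_ℂ) ^ 2 / (1 + b * ‖V‖) ≤ ‖V ψ‖ ^ 2 / (1 + b * ‖V‖) :=
    div_le_div_of_nonneg_right hcs hden.le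
  rw [hVR, inner_sub_right, map_sub, re_inner_real_smul_right, hsym]
  have key : b / (1 + b * ‖V‖) * (re ⟪ψ, V ψ⟫_ℂ) ^ 2 ≤ b * re ⟪V ψ, R (V ψ)⟫_ℂ := by
    calc b / (1 + b * ‖V‖) * (re ⟪ψ, V ψ⟫_ℂ) ^ 2 = b * ((re ⟪ψ, V ψ⟫_ℂ) ^ 2 / (1 + b * ‖V‖)) := by ring
      _ ≤ b * (‖V ψ‖ ^ 2 / (1 + b * ‖V‖)) := by gcongr
      _ ≤ b * re ⟪V ψ, R (V ψ)⟫_ℂ := by gcongr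
  linarith

/-- **A Riccati step is below a cascade step with slightly reduced weight** on the attractive side: for `t ≤ 0`,
`0 ≤ β`, `0 ≤ ε ≤ 1` and `β |t| ≤ ε`: `riccatiStep β t ≤ cascadeStep (β (1 - ε)) t`.  With
`re_inner_mul_inverse_le_sharp` the diagonal of the leading block is therefore a SUBsolution of the cascade flow with
weights `b_k (1 - ε) / (1 + b_k ‖V_k‖)` as long as `b_k |t_k| ≤ ε (1 + b_k ‖V_k‖)`. -/
theorem riccatiStep_le_cascadeStep_of_small {β ε t : ℝ} (hβ : 0 ≤ β) (hε : 0 ≤ ε) (hε1 : ε ≤ 1) (ht : t ≤ 0)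
    (hsmall : β * |t| ≤ ε) : riccatiStep β t ≤ cascadeStep (β * (1 - ε)) t := by
  rw [abs_of_nonpos ht] at hsmall
  have h1 : 0 ≤ β * (1 - ε) := mul_nonneg hβ (by linarith)
  have h2 : β * (1 - ε) * (-t) ≤ 1 / 4 := by
    have : β * (1 - ε) * (-t) = (1 - ε) * (β * -t) := by ring
    rw [this]
    nlinarith [mul_nonneg (sub_nonneg.mpr hε1) (sub_nonneg.mpr hsmall), sq_nonneg (ε - 1 / 2)]
  have hpos : 0 < 1 + β * (1 - ε) * t := by nlinarith
  rw [riccatiStep, cascadeStep, le_div_iff₀ hpos]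
  -- `(t - β t²)(1 + β' t) ≤ t` with `β' = β (1 - ε)`: equivalent to `0 ≤ t² β (ε + β' t)`, and `β' (-t) ≤ β (-t) ≤ ε`
  have h3 : β * (1 - ε) * (-t) ≤ ε := by nlinarith [mul_nonneg (mul_nonneg hβ hε) (neg_nonneg.mpr ht)]
  have h4 : 0 ≤ t ^ 2 * β * (ε - β * (1 - ε) * (-t)) :=
    mul_nonneg (mul_nonneg (sq_nonneg t) hβ) (by linarith)
  nlinarith [h4]

end Sharp

end Summit.HubbardSuperconductivity.HubbardSuperconductivity.Theorems.CooperChannelRiccatiFlow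

end
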